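import Literature.Analysis.Complex.KoebeSquareRootMapLift
import Mathlib.Analysis.Complex.Schwarz
import HarnessLib

/-!
# Uniformization of plane domains, brick N1c (i): one step of the Koebe–Fisher–Hubbard–Wittner tower

PROOF-ONLY file (no definitions; abc-iut cell, seat abc-iut-w5-d038 gen 6, brick «UNIF-G1P · N1c-TOWER»
of abc-iut-L4-t8's programme behind the named fact `Complex.PlaneDomainDiscCovering`, GAP row
G-L4t8g7-1).  Y. Fisher, J. H. Hubbard, B. S. Wittner, *A proof of the uniformization theorem for
arbitrary plane domains*, Proc. AMS **104** (1988) 413–418, §3 Part b «the main construction»: from a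
domain `V ⊆ 𝔻` containing `0` one passes to `V' := 𝔻 ∩ B⁻¹(V)` along Koebe's square-root map `B`
(a two-sheeted Blaschke product with `B 0 = 0`, `B′(0) = 2√|w|/(1+|w|) < 1`, critical value a point
`w ∉ V` nearest to the origin), and iterates.  We run the iteration DRIVEN BY AN EXTREMAL MAP
`F : 𝔻 → U` (`F 0 = 0`, `‖F′(0)‖` maximal among holomorphic maps `𝔻 → U` taking `0` to `0`; brick N1b,
`Complex.exists_norm_deriv_max_of_locallyBounded`): the stage data are an open `V ⊆ 𝔻` with `0 ∈ V`,
the composite `P = B₁ ∘ ⋯ ∘ Bₙ : 𝔻 → 𝔻` (`P 0 = 0`, `P(V) ⊆ U`, `P′(0) = d > 0`), the holomorphic lift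
`G : 𝔻 → V` of `F` (`P ∘ G = F`, `G 0 = 0`), and the BASED HOLOMORPHIC LIFTING PROPERTY of `P` over
`U` (every holomorphic `g : 𝔻 → U` lifts through `P` to `𝔻 → V` through any prescribed point of `V`
over `g 0`).  This file proves:

* `Complex.exists_nearest_not_mem_of_subset_ball` — FHW p. 415 «let `a_n ∈ ∂U_{n-1}` be a point …
  closest to the origin, so that `D(0, |a_n|) ⊂ U_{n-1}`»: for `V ⊊ 𝔻` open with `0 ∈ V` there is
  `w ∈ 𝔻 ∖ V` with `ball 0 ‖w‖ ⊆ V`;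
* **`Complex.exists_koebeTowerStep`** — one step of the tower preserving all the invariants above,
  with the two numerical facts the convergence proof consumes: `d' ≤ d` and, for some radius
  `r ≤ 1` with `ball 0 r ⊆ V`, `(1 - r)²/8 ≤ 1 - d'/d` (w5-d162's exhaustion bound for the square-root
  step `Literature.Analysis.Complex.Koebe.exists_unwinding`, consumed BY NAME; when `V = 𝔻` the step is the identity, `r = 1`).

The iteration and its limits (`d_n ↓ d_∞ ≥ ‖F′(0)‖ > 0`, hence `r_n → 1` and `‖G_n′(0)‖ → 1`) are in
`PlaneDomainKoebeTower.lean`; the disc-lifting property of `F` in `PlaneDomainExtremalDiscLift.lean`.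
Classical mathematics; nothing here touches [IUTchIII] Cor. 3.12.
[cite: FisherHubbardWittner1988, §3 Part b p.415]
-/

noncomputable section

open Set Metric Filter Topology Function

namespace Complex

/-- **A nearest omitted point** (Fisher–Hubbard–Wittner p. 415: «a point on the boundary of `U_{n-1}`
that is closest to the origin, so that `D(0,|a_n|) ⊂ U_{n-1}`»): if `V` is open and does not contain
the whole disc, some `w ∈ 𝔻 ∖ V` has `ball 0 ‖w‖ ⊆ V`.
[cite: FisherHubbardWittner1988, §3 Part b p.415] -/
theorem exists_nearest_not_mem_of_subset_ball {V : Set ℂ} (hVo : IsOpen V)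
    (hne : ¬ ball (0 : ℂ) 1 ⊆ V) :
    ∃ w : ℂ, ‖w‖ < 1 ∧ w ∉ V ∧ ball (0 : ℂ) ‖w‖ ⊆ V := by
  obtain ⟨c, hc, hcV⟩ : ∃ c ∈ ball (0 : ℂ) 1, c ∉ V := by
    by_contra h
    push Not at h
    exact hne h
  set K : Set ℂ := closedBall (0 : ℂ) ‖c‖ ∩ Vᶜ with hK
  have hKc : IsCompact K := (isCompact_closedBall _ _).inter_right hVo.isClosed_compl
  have hcK : c ∈ K := ⟨mem_closedBall_zero_iff.2 le_rfl, hcV⟩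
  obtain ⟨w, hwK, hwmin⟩ := hKc.exists_isMinOn ⟨c, hcK⟩ continuous_norm.continuousOn
  refine ⟨w, ?_, hwK.2, fun z hz => ?_⟩
  · exact (mem_closedBall_zero_iff.1 hwK.1).trans_lt (mem_ball_zero_iff.1 hc)
  · by_contra hzV
    have hzK : z ∈ K :=
      ⟨mem_closedBall_zero_iff.2
        ((mem_ball_zero_iff.1 hz).le.trans (mem_closedBall_zero_iff.1 hwK.1)), hzV⟩
    have h1 : ‖w‖ ≤ ‖z‖ := hwmin hzK
    exact absurd (mem_ball_zero_iff.1 hz) (not_lt.2 h1)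

/-- **One step of the Koebe–Fisher–Hubbard–Wittner tower driven by an extremal map** (FHW §3 Part b,
p. 415; the lifts of Part c, p. 415 «there exist unique analytic mappings `f_n : Ũ → U_n` with
`f_n(0̃) = 0` which make the diagram commute», here with source the disc).  Stage data over a fixed
`U ⊆ ℂ` and `F : ℂ → ℂ`: an open `V ⊆ 𝔻` with `0 ∈ V`; `P` holomorphic on `𝔻` with `P(𝔻) ⊆ 𝔻`,
`P(V) ⊆ U`, `P 0 = 0`, `P′(0) = d > 0`; `G` holomorphic on `𝔻` with `G(𝔻) ⊆ V`, `G 0 = 0`,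
`P ∘ G = F` on `𝔻`; and the based holomorphic lifting property of `P` over `U` into `V`.  CONCLUSION:
new stage data `V', P', G', d'` with the same invariants, `d' ≤ d`, and a radius `0 ≤ r ≤ 1` with
`ball 0 r ⊆ V` and `(1 - r)²/8 ≤ 1 - d'/d` (if `𝔻 ⊆ V` the identity step with `r = 1`; otherwise
`r = ‖w‖` for a nearest omitted point `w` and the square-root step `Koebe.exists_unwinding` at `w`,
`P' = P ∘ B`, `G'` = the based lift of `G` through `B`, `d' = d·B′(0)`).
[cite: FisherHubbardWittner1988, §3 Part b p.415] -/
theorem exists_koebeTowerStep {U : Set ℂ} {F : ℂ → ℂ} {V : Set ℂ} {P G : ℂ → ℂ} {d : ℝ}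
    (hVo : IsOpen V) (hV : V ⊆ ball (0 : ℂ) 1) (hV0 : (0 : ℂ) ∈ V)
    (hP : DifferentiableOn ℂ P (ball 0 1)) (hPm : MapsTo P (ball 0 1) (ball 0 1))
    (hPV : MapsTo P V U) (hP0 : P 0 = 0) (hPd : deriv P 0 = d) (hd : 0 < d)
    (hG : DifferentiableOn ℂ G (ball 0 1)) (hGm : MapsTo G (ball 0 1) V) (hG0 : G 0 = 0)
    (hPG : ∀ z ∈ ball (0 : ℂ) 1, P (G z) = F z)
    (hlift : ∀ g : ℂ → ℂ, DifferentiableOn ℂ g (ball 0 1) → MapsTo g (ball 0 1) U →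
      ∀ y ∈ V, P y = g 0 → ∃ gl : ℂ → ℂ, DifferentiableOn ℂ gl (ball 0 1) ∧
        MapsTo gl (ball 0 1) V ∧ gl 0 = y ∧ ∀ z ∈ ball (0 : ℂ) 1, P (gl z) = g z) :
    ∃ (V' : Set ℂ) (P' G' : ℂ → ℂ) (d' : ℝ),
      (IsOpen V' ∧ V' ⊆ ball (0 : ℂ) 1 ∧ (0 : ℂ) ∈ V' ∧
      DifferentiableOn ℂ P' (ball 0 1) ∧ MapsTo P' (ball 0 1) (ball 0 1) ∧
      MapsTo P' V' U ∧ P' 0 = 0 ∧ deriv P' 0 = d' ∧ 0 < d' ∧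
      DifferentiableOn ℂ G' (ball 0 1) ∧ MapsTo G' (ball 0 1) V' ∧ G' 0 = 0 ∧
      (∀ z ∈ ball (0 : ℂ) 1, P' (G' z) = F z) ∧
      (∀ g : ℂ → ℂ, DifferentiableOn ℂ g (ball 0 1) → MapsTo g (ball 0 1) U →
        ∀ y ∈ V', P' y = g 0 → ∃ gl : ℂ → ℂ, DifferentiableOn ℂ gl (ball 0 1) ∧
          MapsTo gl (ball 0 1) V' ∧ gl 0 = y ∧ ∀ z ∈ ball (0 : ℂ) 1, P' (gl z) = g z)) ∧
      d' ≤ d ∧ ∃ r : ℝ, 0 ≤ r ∧ r ≤ 1 ∧ ball (0 : ℂ) r ⊆ V ∧ (1 - r) ^ 2 / 8 ≤ 1 - d' / d := by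
  by_cases hball : ball (0 : ℂ) 1 ⊆ V
  · -- the identity step
    refine ⟨V, P, G, d, ⟨hVo, hV, hV0, hP, hPm, hPV, hP0, hPd, hd, hG, hGm, hG0, hPG, hlift⟩,
      le_rfl, 1, zero_le_one, le_rfl, hball, ?_⟩
    rw [div_self hd.ne']
    norm_num
  -- the square-root step at a nearest omitted point `w`
  obtain ⟨w, hw1, hwV, hwball⟩ := exists_nearest_not_mem_of_subset_ball hVo hball
  obtain ⟨B, V', β, hBd, hBm, hB0, hBβ, hβ0, hβ1, hbound, hV'o, hV'sub, hV'0, -, hBV, -, hBlift⟩ :=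
    Literature.Analysis.Complex.Koebe.exists_unwinding hVo hV hV0 hw1 hwV
  -- the lift `G'` of `G` through `B`, based at `0`
  obtain ⟨G', hG'd, hG'm, hG'0, hBG'⟩ := hBlift G hG hGm 0 hV'0 (by rw [hB0, hG0])
  have hb0 : ball (0 : ℂ) 1 ∈ 𝓝 (0 : ℂ) := isOpen_ball.mem_nhds (mem_ball_self one_pos)
  refine ⟨V', fun z => P (B z), G', d * β, ⟨hV'o, hV'sub, hV'0, hP.comp hBd hBm, hPm.comp hBm,
    fun z hz => hPV (hBV hz), by simp only [hB0, hP0], ?_, mul_pos hd hβ0, hG'd, hG'm, hG'0,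
    fun z hz => by simp only [hBG' z hz, hPG z hz], ?_⟩, ?_, ‖w‖, norm_nonneg w, hw1.le, hwball, ?_⟩
  · -- `deriv (P ∘ B) 0 = d·β`
    have h1 : DifferentiableAt ℂ B 0 := hBd.differentiableAt hb0
    have h2 : DifferentiableAt ℂ P (B 0) := hP.differentiableAt (by rw [hB0]; exact hb0)
    have : deriv (fun z => P (B z)) 0 = deriv P (B 0) * deriv B 0 := deriv_comp 0 h2 h1
    rw [this, hB0, hPd, hBβ, ofReal_mul]
  · -- the lifting property of `P ∘ B` over `U`, lifts landing in `V'`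
    intro g hg hgU y hy hPy
    obtain ⟨g₁, hg₁d, hg₁m, hg₁0, hPg₁⟩ := hlift g hg hgU (B y) (hBV hy) hPy
    obtain ⟨gl, hgld, hglm, hgl0, hBgl⟩ := hBlift g₁ hg₁d hg₁m y hy hg₁0.symm
    exact ⟨gl, hgld, hglm, hgl0, fun z hz => by simp only [hBgl z hz, hPg₁ z hz]⟩
  · -- `d·β ≤ d`
    exact mul_le_of_le_one_right hd.le hβ1.le
  · -- the exhaustion bound `(1 - ‖w‖)²/8 ≤ 1 - (d β)/d = 1 - β`
    rwa [mul_div_cancel_left₀ β hd.ne']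

end Complex

end
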